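import Summits.MatrixMultiplication.MatrixMultiplication.Theorems.ObstructionDescentUniversalOccurrenceTwoRectangleDominoValue

set_option linter.dupNamespace false
set_option autoImplicit false

/-!
# Universal occurrence — two rectangles and TWO COLUMN PAIRS, part J: `ν = (2N-4, 4)` for all `m ≥ N ≥ 4` (decomp-mm · lens 3 · gen 43)

Route `route-MatrixMultiplication-ObstructionDescent` (sub-problem `MatrixMultiplication`, `ω(ℂ) = 2`); SUPPORT for the crux
`NoOccurrenceObstruction` (`P_O`, item `stmt-MatrixMultiplication-29040`) through the universal-occurrence programme (NODE-g29…g43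
of the decomp-mm cell, lens 3).  Nothing here proves `ω = 2` or closes an item; no `def`, no `sorry`, standard axioms.

**Claim** (`occurs_unitTensor_twoRectangle_twoRowsFour`).  For all `m ≥ N ≥ 4` the type `((2^N),(2^N),(2N-4,4))` occurs in the
coordinate ring of the orbit closure of the unit tensor `⟨m⟩` (in degree `2N`).  With `occurs_unitTensor_twoRectangle_doubleHook`
(`j ≤ 3`), `occurs_unitTensor_twoRectangle_fourTwo` and `occurs_unitTensor_twoRectangle_fourTwoTwo` this certifies in Lean EVERY type
`((2^N),(2^N),ν)` of the two-rectangular sector with `ν₂ ≤ 4` and `ν₃ ≤ 2` (`ν ⊢ 2N` even with at most four rows: `ν ∈ {(2N),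
(2N-2,2), (2N-4,2,2), (2N-6,2,2,2), (2N-4,4), (2N-6,4,2), (2N-8,4,2,2)}`), each at and above its floor `m = N`.

**Proof.**  The K23 floor law (`occurs_unitTensor_twoRectangle_of_pairing_ne_zero`, `δ = 2`) with the design of part I (pair tableau of
`(2N-4,4)`, colouring `g = (0,1,0,1,0,…)`, core columns `[(0,s₀),(1,s₀)] ‖ [(1,s₁),(0,s₁)]`, `[(0,s₂),(1,s₂)] ‖ [(1,s₃),(0,s₃)]`, no
twist): every term is `[e_T(g ∘ w_σ) ≠ 0]` with `e_T(g ∘ w_σ) ∈ {0,1}` (`dominoPair_value_eq_one`), and the witness of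
`dominoPair_witness` makes the sum positive.

[cite: BurgisserIkenmeyer2011, §3.4 (Prop. 3.4), Thm. 4.4] [cite: BurgisserIkenmeyer2017, §5, Thm. 5.9 (proof of (2)), eq. (3.4)]
[cite: Landsberg2017, §9.1.1]
-/

noncomputable section

open scoped BigOperators

namespace Summit.MatrixMultiplication.MatrixMultiplication.Theorems.ObstructionCalculus

open Literature.Computability.AlgebraicComplexity
open Literature.NumberTheory.DiophantineGeometry

set_option maxHeartbeats 400000 in
/-- **`((2^N),(2^N),(2N-4,4))` occurs for `⟨m⟩` for all `m ≥ N ≥ 4`**, uniformly in `N`. [cite: BurgisserIkenmeyer2011, Thm. 4.4]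
[cite: BurgisserIkenmeyer2017, Thm. 5.9 (proof of (2))] -/
theorem occurs_unitTensor_twoRectangle_twoRowsFour {N m : ℕ} (hN : 4 ≤ N) (hNm : N ≤ m)
    {lam : Fin 3 → Nat.Partition (N * 2)} (h0 : lam 0 = Nat.Partition.rectangle N 2)
    (h1 : lam 1 = Nat.Partition.rectangle N 2) (h2 : (lam 2).sortedParts = [2 * N - 4, 4]) :
    isotypicSum₁ (lam 0) (isotypicSum₂ (lam 1) (isotypicSum₃ (lam 2)
      (kroneckerPow (unitTensor ℂ m) (N * 2)))) ≠ 0 := by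
  classical
  -- the shape and the pair tableau `T`
  have hNY : ∀ x ∈ (lam 2).youngDiagram.cells, x.1 < N := fun x hx => by
    have := fst_lt_of_mem_youngDiagram_twoRowsFour (lam 2) h2 hx; omega
  have hd : (lam 2).youngDiagram.cells.card = N * 2 := Nat.Partition.card_cells_youngDiagram _
  obtain ⟨T, hT⟩ : ∃ T : StdFilling (N * 2) (lam 2).youngDiagram, ∀ p : Fin (N * 2), T.1 p =
      (if (p : ℕ) < 2 then ((p : ℕ), 0) else if (p : ℕ) < 4 then ((p : ℕ) - 2, 1)
        else if (p : ℕ) < 6 then ((p : ℕ) - 4, 2) else if (p : ℕ) < 8 then ((p : ℕ) - 6, 3) else (0, (p : ℕ) - 4)) :=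
    ⟨⟨fun p => if (p : ℕ) < 2 then ((p : ℕ), 0) else if (p : ℕ) < 4 then ((p : ℕ) - 2, 1)
        else if (p : ℕ) < 6 then ((p : ℕ) - 4, 2) else if (p : ℕ) < 8 then ((p : ℕ) - 6, 3) else (0, (p : ℕ) - 4),
      ⟨fun p => dominoCell_mem_twoRowsFour hN (lam 2) h2 p p.2,
       fun p q hpq => Fin.ext (dominoCell_injective hpq),
       fun p q hpq => dominoCell_standard hpq⟩⟩, fun p => rfl⟩
  have hM : StdFilling.polytabloid ℂ hNY T ∈
      highestWeightSpace (wordRep ℂ N (N * 2)) (Weight.ofPartition N (lam 2)) := by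
    rw [← ydWeight_youngDiagram]; exact StdFilling.polytabloid_mem hNY T hd
  -- the slots, the positions and the block structures
  obtain ⟨s0, hs0⟩ : ∃ s : Fin N, (s : ℕ) = 0 := ⟨⟨0, by omega⟩, rfl⟩
  obtain ⟨s1, hs1⟩ : ∃ s : Fin N, (s : ℕ) = 1 := ⟨⟨1, by omega⟩, rfl⟩
  obtain ⟨p2, hp2⟩ : ∃ p : Fin (N * 2), (p : ℕ) = 2 := ⟨⟨2, by omega⟩, rfl⟩
  obtain ⟨p3, hp3⟩ : ∃ p : Fin (N * 2), (p : ℕ) = 3 := ⟨⟨3, by omega⟩, rfl⟩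
  obtain ⟨p6, hp6⟩ : ∃ p : Fin (N * 2), (p : ℕ) = 6 := ⟨⟨6, by omega⟩, rfl⟩
  obtain ⟨p7, hp7⟩ : ∃ p : Fin (N * 2), (p : ℕ) = 7 := ⟨⟨7, by omega⟩, rfl⟩
  obtain ⟨ξ, hξ⟩ : ∃ ξ : Equiv.Perm (Fin (N * 2)), ξ = Equiv.swap p2 p3 * Equiv.swap p6 p7 := ⟨_, rfl⟩
  have hξv : ∀ q : Fin (N * 2), ((ξ q : Fin (N * 2)) : ℕ) =
      if (q : ℕ) = 2 then 3 else if (q : ℕ) = 3 then 2 else if (q : ℕ) = 6 then 7 else if (q : ℕ) = 7 then 6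
      else (q : ℕ) := by
    intro q
    rw [hξ, Equiv.Perm.mul_apply, Equiv.swap_apply_def, Equiv.swap_apply_def]
    simp only [Fin.ext_iff, hp2, hp3, hp6, hp7]
    split_ifs <;> omega
  obtain ⟨e, he⟩ : ∃ e : Fin (N * 2) ≃ Fin 2 × Fin N,
      e = ξ.trans (finProdFinEquiv.symm.trans (Equiv.prodComm (Fin N) (Fin 2))) := ⟨_, rfl⟩
  have hev : ∀ q : Fin (N * 2), (((e q).1 : Fin 2) : ℕ) = ((ξ q : Fin (N * 2)) : ℕ) % 2 ∧
      (((e q).2 : Fin N) : ℕ) = ((ξ q : Fin (N * 2)) : ℕ) / 2 := by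
    intro q; rw [he]; simp [Fin.modNat, Fin.divNat]
  -- no twist: `H = ∅`, `e' = e` (as the trivial involution)
  obtain ⟨H, hH⟩ : ∃ H : Finset (Fin N), H = ∅ := ⟨_, rfl⟩
  have hHv : ∀ s : Fin N, s ∈ H ↔ False := by intro s; rw [hH]; simp
  let F : Fin 2 × Fin N → Fin 2 × Fin N := fun x => (if x.2 ∈ H then Fin.rev x.1 else x.1, x.2)
  have hF : Function.Involutive F := by
    rintro ⟨a, s⟩; by_cases hs : s ∈ H <;> simp [F, hs, Fin.rev_rev]
  obtain ⟨e', he'⟩ : ∃ e' : Fin (N * 2) ≃ Fin 2 × Fin N,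
      ∀ q, e' q = (if (e q).2 ∈ H then Fin.rev (e q).1 else (e q).1, (e q).2) :=
    ⟨e.trans (Function.Involutive.toPerm F hF), fun q => rfl⟩
  -- the colouring `g = (0,1,0,1,0,0,…)`
  obtain ⟨g, hg⟩ : ∃ g : Fin N → Fin N, ∀ i, g i = if ((i : ℕ) = 1 ∨ (i : ℕ) = 3) then s1 else s0 :=
    ⟨_, fun i => rfl⟩
  have hgv : ∀ i : Fin N, ((g i : Fin N) : ℕ) = if ((i : ℕ) = 1 ∨ (i : ℕ) = 3) then 1 else 0 := by
    intro i; rw [hg]; split_ifs <;> omega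
  -- evaluation of the words `g ∘ w_σ` at the positions
  have hpos : ∀ (σ : Fin 2 → Equiv.Perm (Fin N)) (n : ℕ) (hn : n < N * 2) (a : Fin 2) (s : Fin N),
      (if n = 2 then 3 else if n = 3 then 2 else if n = 6 then 7 else if n = 7 then 6 else n) % 2 = (a : ℕ) →
      (if n = 2 then 3 else if n = 3 then 2 else if n = 6 then 7 else if n = 7 then 6 else n) / 2 = (s : ℕ) →
      (g ∘ fun q => σ (e q).1 (e q).2) ⟨n, hn⟩ = g (σ a s) := by
    intro σ n hn a s ha hs
    obtain ⟨h1, h2⟩ := hev ⟨n, hn⟩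
    rw [hξv] at h1 h2
    dsimp only at h1 h2
    have ha' : (e ⟨n, hn⟩).1 = a := Fin.ext (by rw [h1, ha])
    have hs' : (e ⟨n, hn⟩).2 = s := Fin.ext (by rw [h2, hs])
    show g (σ (e ⟨n, hn⟩).1 (e ⟨n, hn⟩).2) = _
    rw [ha', hs']
  -- the summands are `0` or `1`
  have hterm : ∀ σ : Fin 2 → Equiv.Perm (Fin N),
      (∏ a, ((Equiv.Perm.sign (σ a) : ℤ) : ℂ)) *
          (wordBlockSign ℂ e' (fun q => σ (e q).1 (e q).2) *
            ∑ w, StdFilling.polytabloid ℂ hNY T w *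
              ∏ q, (fun i l : Fin N => if l = g i then (1 : ℂ) else 0) (σ (e q).1 (e q).2) (w q)) =
        if StdFilling.polytabloid ℂ hNY T (g ∘ fun q => σ (e q).1 (e q).2) ≠ 0 then 1 else 0 := by
    intro σ
    have hc : (∑ w, StdFilling.polytabloid ℂ hNY T w *
        ∏ q, (fun i l : Fin N => if l = g i then (1 : ℂ) else 0) (σ (e q).1 (e q).2) (w q)) =
        StdFilling.polytabloid ℂ hNY T (g ∘ fun q => σ (e q).1 (e q).2) :=
      sum_mul_prod_indicator_eq _ g _
    have hval : ∀ s, (σ 0)⁻¹ (σ 1 s) ∈ H ↔ s ∈ H := fun s => by rw [hHv, hHv]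
    rw [hc, ← mul_assoc, sign_mul_wordBlockSign_twist e e' H he' σ, if_pos hval, one_mul]
    by_cases hz : StdFilling.polytabloid ℂ hNY T (g ∘ fun q => σ (e q).1 (e q).2) = 0
    · rw [if_neg (fun h => h hz), hz]
    · rw [if_pos hz]
      exact dominoPair_value_eq_one hN hNY T hT e g hgv hpos σ hz
  refine occurs_unitTensor_twoRectangle_of_pairing_ne_zero hNm e e' h0 h1 hM
    (fun i l => if l = g i then (1 : ℂ) else 0) ?_
  intro hsum
  rw [Finset.sum_congr rfl (fun σ _ => hterm σ), Finset.sum_boole, Nat.cast_eq_zero,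
    Finset.card_eq_zero, Finset.filter_eq_empty_iff] at hsum
  obtain ⟨σw, hne⟩ := dominoPair_witness hN hNY T hT e g hgv hpos
  exact hsum (Finset.mem_univ σw) hne

end Summit.MatrixMultiplication.MatrixMultiplication.Theorems.ObstructionCalculus
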